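import Literature.MathematicalPhysics.QuantumFieldTheory.Balaban1983to89.Node00.Record13BgRowAtDatumUOfClassC1
import Literature.MathematicalPhysics.QuantumFieldTheory.Balaban1983to89.Node00.Record12BgRowTopDomain

/-!
# NODE 00 (YM-PLAN Track A) — STAGE 13: ROW P11's BODY PER DATUM FOR AN ARBITRARY CONFIGURATION `U` FROM THE TWO CLASS BOUNDS AT THE POSITIVE SCALES `1 ≤ m ≤ n` ONLY —
# node00-def-P11's `bgRowAtDatumU_of_classBoundsC1Pos` (12a `Record12BgRowTopDomain` §4: FILE 10's U-generic assembly with the scale-0 bound DROPPED) LIFTED TO THE STAGE-13 PARAMETER,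
# AT `θ` AND AT `θ₁₅ᶜᶜ¹` — the EDITION-FREE supplier for the v1.5 `CoP` closers (scale 0 = print's Ω₀(s), not `T_η`)

Cell `pub-ymgap`, seat `pub-ymgap-node00-def-K0a` (g7), FILE 14g (Pos twin of FILE 14c `Record13BgRowAtDatumUOfClassC1` §1∕§2).  [15] = [Balaban1985Variational], [6] = [Balaban1985RegularSpaces],
[III] = [Balaban1988Convergent], [I] = [Balaban1987RG1].

WHY (director-ym №160∕№161 (y): rev 20 keys on v1.5 `CoP`, whose background `UbgMSCoPOfRecord` (node00-def-R FILE 22′) minimises over print's class ON Ω₀(s) = the support domain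
([III] p.255; [15] p.277 (1)–(2)), leaving the datum `W 0` beyond Ω₀(s) as fixed — possibly ROUGH — data).  FILE 14c's displayed C⁰ clause ranges over `m ≤ n`, and at `m = 0`
`omegaPlaqs s.Ω 0 = Set.univ` (FILE 16 :69) — all of `T_η`: harmless at v1.4 (the (1.7)₀ class was itself on `T_η`), FALSE at v1.5 for rough exterior data.  The row's body at scales
`1 ≤ j ≤ n` never reads the scale-0 bound (def-P11 12a: «FILE 10's … with the scale-0 bound dropped»), so the CoP-ready supplier displays the bounds for `1 ≤ m ≤ n` only.  This
file is that supplier; it names no background, no support, no proviso, no Ω₀ — whatever def-T's 24T carrier and def-R's 22′ class literal are, the v1.5 Cut A closer is this restricted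
to the CoP range by `cases n; rw [UbgOfRecord₁₃CoP_succ]; by_cases hsol` (successor FILE 16b).

WHAT THIS FILE PROVES (theorems only; 0 `def`).
* §1 (generic `θ`) ★ `Stage13Params.bgAtDatumUPos_of_classBoundsC1 (θ) (hθ) (hRz) (hB₃ hB₃') (hM) (hε0 hBα hsN hcB hBCM hsmallI hsmallMS hC1 hletterI hletterMS)` :
  `∀ p n, n ≤ p.K → window → PartCompat₁₃ θ p n → ∀ s (U : GaugeField (F.P p.K) 0 (SU N)), (∀ m, 1 ≤ m → m ≤ n → C⁰_m(s, U)) → (∀ m, 1 ≤ m → m ≤ n → C¹_m(s, U)) → ∀ j, 1 ≤ j ≤ n → ∀ X, (I)(U) ∧ (MS)(U)`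
  (FILE 14c §1's letters verbatim; def-P11's `…C1Pos` at `S := settingOfRecord₁₃ F N θ p`).
* §2 (at `θ₁₅ᶜᶜ¹`, signs only) ★★★ `bgAtDatumUPos_theta13OfThm1CC1_of_pos (hε hε' hB hB' ha₀ ha₁)` (every letter by FILE 13b §2).  (The unit branch is FILE 14c's `bgAtDatum_one_…`, unchanged.)

HONEST FRAMING.  Composition of tree theorems + index bookkeeping; CONDITIONAL on the DISPLAYED class bounds at the positive scales; nothing of Bałaban asserted; NOT a discharge;
K0⁗∕K0⁵ NOT closed; counts unmoved (typed 28∕28 · discharged 5∕28); one finite 𝕋⁴ programme at fixed ε — NOT continuum ∕ OS ∕ mass gap ∕ Clay.  No `sorry`, `axiom`, `def`, `instance`, `notation`.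
-/

noncomputable section

open MeasureTheory
open scoped Matrix.Norms.L2Operator

namespace Literature.MathematicalPhysics.QuantumFieldTheory.Balaban1983to89.Node00

open T4Continuum B14.Eq218Concrete B15DeterminingSets B12RegularSpaces111 B14RegularSpaces234 B14Radii T4AxialGaugeSmallField

/-! ## §1. ★ node00-def-P11's `bgRowAtDatumU_of_classBoundsC1Pos` LIFTED TO THE STAGE-13 PARAMETER (class bounds at `1 ≤ m ≤ n` only; letters as FILE 14c) -/

section LiftUPos

variable {F : T4Family} {N : ℕ} [NeZero N]

/-- **★ ROW P11's BODY FOR AN ARBITRARY CONFIGURATION `U` AT THE STAGE-13 RECORD, FROM THE TWO CLASS BOUNDS FOR `U` AT THE SCALES `1 ≤ m ≤ n` ONLY** — node00-def-P11's `bgRowAtDatumU_of_classBoundsC1Pos` at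
`S := settingOfRecord₁₃ F N θ p`, level `n` (no split: no background token to unfold), with `b m := B₃·(cR·ε_m)`, `b′ m := B₃′·(cR·ε_m)`, the radii positive from admissibility in the
window and (C2) from the run-level antecedent `PartCompat₁₃ F N θ p n`: for every run `p`, level `n ≤ K` in the window with compatible partitions, EVERY sequence `s` and EVERY
`U : GaugeField (F.P p.K) 0 (SU N)`, the bounds `|U(∂p) − 1| < B₃·cR·ε_m·η_m²` on `omegaPlaqs s.Ω m` (`1 ≤ m ≤ n` — NO scale-0 ∕ `T_η` clause) and covariant adjacent-plaquette differences `< B₃′·cR·ε_m·η_m³` inside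
`Ω_m` (`1 ≤ m ≤ n`) imply `U ∈ U^c_j(X, α₀, α₁)` for `X ⊆ Λ_j` and `U ∈ Ũ^c_j(X)` for admissible `X`, `1 ≤ j ≤ n`.  A REDUCTION — nothing of Bałaban asserted.
[cite: Balaban1985Variational, Thm 1 (8)–(10) p.279; Balaban1985RegularSpaces, (1.7)–(1.9) p.77; Balaban1988Convergent, (2.10) p.256, (2.27)–(2.28) p.259, (2.34)–(2.41) p.261, p.257; Balaban1987RG1, (1.11)–(1.16) p.262] -/
theorem Stage13Params.bgAtDatumUPos_of_classBoundsC1 (θ : Stage13Params F N) (hθ : θ.Admissible F N) (hRz : θ.Rz = RzOfRecord F N)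
    {B₃ B₃' : ℝ} (hB₃ : 0 ≤ B₃) (hB₃' : 0 ≤ B₃') (hM : 0 < θ.τ9.M)
    (hε0 : ∀ (p : B12.RunParams) (n : ℕ), n ≤ p.K → Step.InInterval θ.γ n (gOfRecord₁₃ F N θ p) → ∀ m, m ≤ n → 0 ≤ θ.s2.cR * epsOfRecord θ.ν (gOfRecord₁₃ F N θ p) m)
    (hBα : ∀ (p : B12.RunParams) (n : ℕ), n ≤ p.K → Step.InInterval θ.γ n (gOfRecord₁₃ F N θ p) → ∀ m, 1 ≤ m → m ≤ n →
      B₃ * (θ.s2.cR * epsOfRecord θ.ν (gOfRecord₁₃ F N θ p) m) ≤ (1 - θ.s2.βc) * (lfOfRecord₁₂ F N θ.toStage12Params).alpha0 (gOfRecord₁₃ F N θ p m))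
    (hsN : ∀ (p : B12.RunParams) (n : ℕ), n ≤ p.K → ∀ n', 1 ≤ n' → n' ≤ n + 1 →
      ((B14.Eq213MaximalDomains.side (F.P p.K).L θ.τ9.M n' : ℕ) : ℤ) < (F.P p.K).sitesPerDir 0)
    (hcB : ∀ p : B12.RunParams, 2 * (((F.P p.K).d - 1 : ℕ) : ℝ) * ((F.P p.K).L * θ.τ9.M) < θ.s2.cB)
    (hBCM : ∀ p : B12.RunParams, 2 * (((F.P p.K).d - 1 : ℕ) : ℝ) * θ.τ9.M < θ.s2.B * θ.s2.C * θ.s2.Mr)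
    (hsmallI : ∀ (p : B12.RunParams) (n : ℕ), n ≤ p.K → Step.InInterval θ.γ n (gOfRecord₁₃ F N θ p) → ∀ j, 1 ≤ j → j ≤ n →
      (((F.P p.K).d - 1 : ℕ) : ℝ) * ((F.P p.K).L * θ.τ9.M) * (F.P p.K).eta j * (B₃ * (θ.s2.cR * epsOfRecord θ.ν (gOfRecord₁₃ F N θ p) j)) ≤ 1 / 2)
    (hsmallMS : ∀ (p : B12.RunParams) (n : ℕ), n ≤ p.K → Step.InInterval θ.γ n (gOfRecord₁₃ F N θ p) → ∀ m, 1 ≤ m → m ≤ n →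
      (((F.P p.K).d - 1 : ℕ) : ℝ) * θ.τ9.M * (F.P p.K).eta m * (B₃ * (θ.s2.cR * epsOfRecord θ.ν (gOfRecord₁₃ F N θ p) m)) ≤ 1 / 2)
    (hC1 : ∀ (p : B12.RunParams) (n : ℕ), n ≤ p.K → Step.InInterval θ.γ n (gOfRecord₁₃ F N θ p) → ∀ j, 1 ≤ j → j ≤ n →
      ∃ t : ℕ, 0 < t ∧ RkOfRecord (F.P p.K).L θ.ν.r (gOfRecord₁₃ F N θ p j) = (F.P p.K).L * t)
    (hletterI : ∀ (p : B12.RunParams) (n : ℕ), n ≤ p.K → Step.InInterval θ.γ n (gOfRecord₁₃ F N θ p) → ∀ j, 1 ≤ j → j ≤ n →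
      4 * (B₃ * (θ.s2.cR * epsOfRecord θ.ν (gOfRecord₁₃ F N θ p) j) + (((F.P p.K).d - 1 : ℕ) : ℝ) * (((F.P p.K).L : ℝ) * θ.τ9.M) * (B₃' * (θ.s2.cR * epsOfRecord θ.ν (gOfRecord₁₃ F N θ p) j)) +
        4 * ((((F.P p.K).d - 1 : ℕ) : ℝ) * (((F.P p.K).L : ℝ) * θ.τ9.M)) ^ 2 * (B₃ * (θ.s2.cR * epsOfRecord θ.ν (gOfRecord₁₃ F N θ p) j)) ^ 2) <
        θ.s2.cB * (lfOfRecord₁₂ F N θ.toStage12Params).alpha0 (gOfRecord₁₃ F N θ p j))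
    (hletterMS : ∀ (p : B12.RunParams) (n : ℕ), n ≤ p.K → Step.InInterval θ.γ n (gOfRecord₁₃ F N θ p) → ∀ m, 1 ≤ m → m ≤ n →
      4 * (B₃ * (θ.s2.cR * epsOfRecord θ.ν (gOfRecord₁₃ F N θ p) m) + (((F.P p.K).d - 1 : ℕ) : ℝ) * (θ.τ9.M : ℝ) * (B₃' * (θ.s2.cR * epsOfRecord θ.ν (gOfRecord₁₃ F N θ p) m)) +
        4 * ((((F.P p.K).d - 1 : ℕ) : ℝ) * (θ.τ9.M : ℝ)) ^ 2 * (B₃ * (θ.s2.cR * epsOfRecord θ.ν (gOfRecord₁₃ F N θ p) m)) ^ 2) <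
        rad238 θ.s2.B θ.s2.C θ.s2.Mr ((lfOfRecord₁₂ F N θ.toStage12Params).alpha0 (gOfRecord₁₃ F N θ p m))) :
    ∀ (p : B12.RunParams) (n : ℕ), n ≤ p.K → Step.InInterval θ.γ n (gOfRecord₁₃ F N θ p) → PartCompat₁₃ F N θ p n →
      ∀ (s : SeqOfRecord F θ.ν θ.τ9.M (gOfRecord₁₃ F N θ p) p.K n) (U : GaugeField (F.P p.K) 0 (SU N)),
      (∀ m, 1 ≤ m → m ≤ n → PlaqSmallOn (omegaPlaqs s.Ω m) (B₃ * (θ.s2.cR * epsOfRecord θ.ν (gOfRecord₁₃ F N θ p) m) * (F.P p.K).eta m ^ 2) U) →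
      (∀ m, 1 ≤ m → m ≤ n → PlaqC1SmallOn (plaqInside (s.Ω m)) (B₃' * (θ.s2.cR * epsOfRecord θ.ν (gOfRecord₁₃ F N θ p) m) * (F.P p.K).eta m ^ 3) U) →
      ∀ j, 1 ≤ j → j ≤ n → ∀ X : (Sect2.domSys (F.P p.K) θ.τ9.M j).Dom,
      (Sect2.domSites (F.P p.K) θ.τ9.M j X ⊆ s.Λ j →
        Sect2.ofBackgroundC (settingOfRecord₁₃ F N θ p).ι U ∈
          Sect2.spaceI (settingOfRecord₁₃ F N θ p) (θ.Rz p.K) θ.τ9.M j (Sect2.domSites (F.P p.K) θ.τ9.M j X)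
            ((settingOfRecord₁₃ F N θ p).lf.alpha0 ((settingOfRecord₁₃ F N θ p).flow.g j)) ((settingOfRecord₁₃ F N θ p).lf.alpha1 ((settingOfRecord₁₃ F N θ p).flow.g j))) ∧
      (Sect2.admB (F.P p.K) θ.ν θ.τ9.M (gOfRecord₁₃ F N θ p) s.Ω s.Λ j (Sect2.domSites (F.P p.K) θ.τ9.M j X) = true →
        Sect2.ofBackgroundC (settingOfRecord₁₃ F N θ p).ι U ∈
          Sect2.spaceMS (settingOfRecord₁₃ F N θ p) (θ.Rz p.K) θ.τ9.M j (Sect2.domSites (F.P p.K) θ.τ9.M j X) s.Ω) := by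
  intro p n hn hw hpc
  rw [hRz]
  exact fun s U hc0 hc1 j h1 hj X =>
    bgRowAtDatumU_of_classBoundsC1Pos (settingOfRecord₁₃ F N θ p) rfl rfl (settingOfRecord₁₃_laws F N θ p) (settingOfRecord₁₃_pos F N θ hθ.1.pos p) θ.ν hM p.K n
      (b := fun m => B₃ * (θ.s2.cR * epsOfRecord θ.ν (gOfRecord₁₃ F N θ p) m)) (b' := fun m => B₃' * (θ.s2.cR * epsOfRecord θ.ν (gOfRecord₁₃ F N θ p) m))
      (fun m _ hm => mul_nonneg hB₃ (hε0 p n hn hw m hm)) (fun m _ hm => mul_nonneg hB₃' (hε0 p n hn hw m hm)) s U hc0 hc1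
      (fun m _ hm => alphaPos₁₃_of_inInterval hθ hw hm)
      (hBα p n hn hw) (hsN p n hn) (hcB p) (hBCM p) (hsmallI p n hn hw) (hsmallMS p n hn hw) (hC1 p n hn hw) hpc
      (hletterI p n hn hw) (hletterMS p n hn hw) j h1 hj X

end LiftUPos

/-! ## §2. ★★★ AT `θ₁₅ᶜᶜ¹`: row P11's body for an arbitrary `U` from the two class bounds at the positive scales — NOTHING BUT THE SIGNS AS HYPOTHESES -/

section AtWitnessUPos

variable {F : T4Family} {N : ℕ} [NeZero N] {ε₀ ε₂₉ B₃ B₃' a₀ a₁ : ℝ}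

/-- **★★★ ROW P11's BODY FOR AN ARBITRARY CONFIGURATION `U` AT `θ₁₅ᶜᶜ¹ = theta13OfThm1CC1 F N ε₀ ε₂₉ B₃ B₃' a₀ a₁` — THE BACKGROUND-FREE, SCALE-0-FREE SUPPLIER**: under the signs `0 < ε₀`,
`0 < ε₂₉`, `0 ≤ B₃`, `0 ≤ B₃′`, `0 < a₀`, `0 < a₁` ONLY — for every run `p`, level `n ≤ K` in the window with compatible partitions, every sequence `s` and every `U`: the C⁰ bound on
`omegaPlaqs s.Ω m` (`1 ≤ m ≤ n`) and the C¹ bound inside `Ω_m` (`1 ≤ m ≤ n`) for `U` imply (I) ∧ (MS) for `U` (`1 ≤ j ≤ n`) — every numerics letter, (C1), no wrapping and both C¹-route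
letters by FILE 13b §2, (C2) from the antecedent.  CONDITIONAL on the two bounds; nothing of Bałaban asserted.
[cite: Balaban1985Variational, Thm 1 (8)–(10) p.279; Balaban1985RegularSpaces, (1.7)–(1.9) p.77; Balaban1988Convergent, (2.10) p.256, (2.27)–(2.28) p.259, (2.34)–(2.41) p.261, p.257; Balaban1987RG1, (1.11)–(1.16) p.262] -/
theorem bgAtDatumUPos_theta13OfThm1CC1_of_pos (hε : 0 < ε₀) (hε' : 0 < ε₂₉) (hB : 0 ≤ B₃) (hB' : 0 ≤ B₃') (ha₀ : 0 < a₀) (ha₁ : 0 < a₁) :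
    ∀ (p : B12.RunParams) (n : ℕ), n ≤ p.K → Step.InInterval (theta13OfThm1CC1 F N ε₀ ε₂₉ B₃ B₃' a₀ a₁).γ n (gOfRecord₁₃ F N (theta13OfThm1CC1 F N ε₀ ε₂₉ B₃ B₃' a₀ a₁) p) → PartCompat₁₃ F N (theta13OfThm1CC1 F N ε₀ ε₂₉ B₃ B₃' a₀ a₁) p n →
      ∀ (s : SeqOfRecord F (theta13OfThm1CC1 F N ε₀ ε₂₉ B₃ B₃' a₀ a₁).ν (theta13OfThm1CC1 F N ε₀ ε₂₉ B₃ B₃' a₀ a₁).τ9.M (gOfRecord₁₃ F N (theta13OfThm1CC1 F N ε₀ ε₂₉ B₃ B₃' a₀ a₁) p) p.K n) (U : GaugeField (F.P p.K) 0 (SU N)),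
      (∀ m, 1 ≤ m → m ≤ n → PlaqSmallOn (omegaPlaqs s.Ω m) (B₃ * ((theta13OfThm1CC1 F N ε₀ ε₂₉ B₃ B₃' a₀ a₁).s2.cR * epsOfRecord (theta13OfThm1CC1 F N ε₀ ε₂₉ B₃ B₃' a₀ a₁).ν (gOfRecord₁₃ F N (theta13OfThm1CC1 F N ε₀ ε₂₉ B₃ B₃' a₀ a₁) p) m) * (F.P p.K).eta m ^ 2) U) →
      (∀ m, 1 ≤ m → m ≤ n → PlaqC1SmallOn (plaqInside (s.Ω m)) (B₃' * ((theta13OfThm1CC1 F N ε₀ ε₂₉ B₃ B₃' a₀ a₁).s2.cR * epsOfRecord (theta13OfThm1CC1 F N ε₀ ε₂₉ B₃ B₃' a₀ a₁).ν (gOfRecord₁₃ F N (theta13OfThm1CC1 F N ε₀ ε₂₉ B₃ B₃' a₀ a₁) p) m) * (F.P p.K).eta m ^ 3) U) →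
      ∀ j, 1 ≤ j → j ≤ n → ∀ X : (Sect2.domSys (F.P p.K) (theta13OfThm1CC1 F N ε₀ ε₂₉ B₃ B₃' a₀ a₁).τ9.M j).Dom,
      (Sect2.domSites (F.P p.K) (theta13OfThm1CC1 F N ε₀ ε₂₉ B₃ B₃' a₀ a₁).τ9.M j X ⊆ s.Λ j →
        Sect2.ofBackgroundC (settingOfRecord₁₃ F N (theta13OfThm1CC1 F N ε₀ ε₂₉ B₃ B₃' a₀ a₁) p).ι U ∈
          Sect2.spaceI (settingOfRecord₁₃ F N (theta13OfThm1CC1 F N ε₀ ε₂₉ B₃ B₃' a₀ a₁) p) ((theta13OfThm1CC1 F N ε₀ ε₂₉ B₃ B₃' a₀ a₁).Rz p.K) (theta13OfThm1CC1 F N ε₀ ε₂₉ B₃ B₃' a₀ a₁).τ9.M j (Sect2.domSites (F.P p.K) (theta13OfThm1CC1 F N ε₀ ε₂₉ B₃ B₃' a₀ a₁).τ9.M j X)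
            ((settingOfRecord₁₃ F N (theta13OfThm1CC1 F N ε₀ ε₂₉ B₃ B₃' a₀ a₁) p).lf.alpha0 ((settingOfRecord₁₃ F N (theta13OfThm1CC1 F N ε₀ ε₂₉ B₃ B₃' a₀ a₁) p).flow.g j)) ((settingOfRecord₁₃ F N (theta13OfThm1CC1 F N ε₀ ε₂₉ B₃ B₃' a₀ a₁) p).lf.alpha1 ((settingOfRecord₁₃ F N (theta13OfThm1CC1 F N ε₀ ε₂₉ B₃ B₃' a₀ a₁) p).flow.g j))) ∧
      (Sect2.admB (F.P p.K) (theta13OfThm1CC1 F N ε₀ ε₂₉ B₃ B₃' a₀ a₁).ν (theta13OfThm1CC1 F N ε₀ ε₂₉ B₃ B₃' a₀ a₁).τ9.M (gOfRecord₁₃ F N (theta13OfThm1CC1 F N ε₀ ε₂₉ B₃ B₃' a₀ a₁) p) s.Ω s.Λ j (Sect2.domSites (F.P p.K) (theta13OfThm1CC1 F N ε₀ ε₂₉ B₃ B₃' a₀ a₁).τ9.M j X) = true →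
        Sect2.ofBackgroundC (settingOfRecord₁₃ F N (theta13OfThm1CC1 F N ε₀ ε₂₉ B₃ B₃' a₀ a₁) p).ι U ∈
          Sect2.spaceMS (settingOfRecord₁₃ F N (theta13OfThm1CC1 F N ε₀ ε₂₉ B₃ B₃' a₀ a₁) p) ((theta13OfThm1CC1 F N ε₀ ε₂₉ B₃ B₃' a₀ a₁).Rz p.K) (theta13OfThm1CC1 F N ε₀ ε₂₉ B₃ B₃' a₀ a₁).τ9.M j (Sect2.domSites (F.P p.K) (theta13OfThm1CC1 F N ε₀ ε₂₉ B₃ B₃' a₀ a₁).τ9.M j X) s.Ω) :=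
  (theta13OfThm1CC1 F N ε₀ ε₂₉ B₃ B₃' a₀ a₁).bgAtDatumUPos_of_classBoundsC1 (admissible_theta13OfThm1CC1 F N hε hε' hB hB' ha₀ ha₁) rfl hB hB'
    (by rw [theta13OfThm1CC1_τ9_M]; exact Nat.one_pos) (hε0_theta13OfThm1CC1 hB hB' ha₀ ha₁) (hBα_theta13OfThm1CC1 hB hB' ha₀.le ha₁.le) hsN_theta13OfThm1CC1 hcB_theta13OfThm1CC1 hBCM_theta13OfThm1CC1
    (hsmallI_theta13OfThm1CC1 hB hB' ha₀ ha₁) (hsmallMS_theta13OfThm1CC1 hB hB' ha₀ ha₁) hC1_theta13OfThm1CC1 (hletterI_theta13OfThm1CC1 hB hB' ha₀ ha₁) (hletterMS_theta13OfThm1CC1 hB hB' ha₀ ha₁)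

end AtWitnessUPos

end Literature.MathematicalPhysics.QuantumFieldTheory.Balaban1983to89.Node00

end
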